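import Summits.AtomisticToContinuum.HydrodynamicLimit.Theorems.AntiMazurCoboundariesCellForecastPressureDecayKinematicAssemblyError
import Summits.AtomisticToContinuum.HydrodynamicLimit.Theorems.AntiMazurCoboundariesCellForecastPressureDecayKinematicAssemblyStaticMain
import HarnessLib

/-!
# S2d′ · the kinematic assembly from the cluster tail: `ClusterTail σ → KinematicRates σ`
# (registered stub `stub_kinematicAssemblyOfTail` of the crux line `enskog-compensator-martingale`,
# crux `CellForecastPressureDecay`, stmt-AtomisticToContinuum-13915)

The closing file of stub S2d′: for `0 < σ < 3/16`, the statics of the canonical cell law (`CellLawFactorises`,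
`ContactLayerBounds`, `ContactStatistics`) and the short-time cluster tail `ClusterTail σ` imply the equal-time Enskog
kinematics `KinematicRates σ` — against any bounded continuous functional `F` of the initial velocities, the one-slab
increment `∑ᵢ [w(vᵢ(Δ)) − w(vᵢ(0))]` of the whole-cell hard-sphere flow equals `Δ c₂' ∑_{i≠j} K_w(vᵢ, vⱼ)` up to
`C (L³Δ² + L²Δ)`, with ONE static constant `c₂' = c₂σ²/(2n(n−1))` (`c₂` the contact constant of the pair statistics).

* `exists_pairFunctional` — the explicit pair functional `φ_{v,u}(q) = 1_{Cyl}(q) · [w(v') + w(u') − w(v) − w(u)]` of a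
  slab as a JOINTLY measurable family with the clauses of `stub_kinematicAssembly_mainTerm` (on/off the cylinder, shell
  support, `|φ| ≤ 4b`, `∫ φ_{v,u} = σ²Δ K_w(v, u)`);
* `stub_kinematicAssemblyOfTail` — the assembly: pathwise bookkeeping integrated against the cluster tail
  (`stub_kinematicAssemblyOfTail_error`) for `Δ ≤ δ₀`, static main term (`stub_kinematicAssemblyOfTail_staticMain`),
  and the crude bound `2bn + Δ c₂' · 64bπn²M₄ ≤ C L³ Δ²/δ₀²` for the long slabs `Δ > δ₀`.

References: Cercignani–Illner–Pulvirenti 1994, §2.2, §4.2–4.3; Spohn 1991, §8.4.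
-/

noncomputable section

open MeasureTheory ProbabilityTheory Set Filter Topology
open scoped ENNReal BigOperators InnerProductSpace
open Literature.Analysis.FluidPDE Literature.MathematicalPhysics.KineticTheory
open Summit.AtomisticToContinuum.HydrodynamicLimit.Theorems.CellForecastPressureDecay (isProbabilityMeasure_cellLaw)

namespace Summit.AtomisticToContinuum.HydrodynamicLimit.Theorems.EnskogCompensator

/-! ## The explicit pair functional of a slab -/

/-- The two-body jump read through the impact direction `σ⁻¹(q + τ(q, v − u)(v − u))` is jointly measurable in
`(v, u, q)`. [folklore] -/
theorem measurable_twoBodyJump_dir (σ : ℝ) {w : V3 → ℝ} (hw : Continuous w) :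
    Measurable fun p : V3 × V3 × V3 =>
      w (reflectVel (σ • (σ⁻¹ • (p.2.2 + pairHitTime σ p.2.2 (p.1 - p.2.1) • (p.1 - p.2.1)))) (p.1, p.2.1)).1 +
        w (reflectVel (σ • (σ⁻¹ • (p.2.2 + pairHitTime σ p.2.2 (p.1 - p.2.1) • (p.1 - p.2.1)))) (p.1, p.2.1)).2 -
        w p.1 - w p.2.1 := by
  have hwm : Measurable w := hw.measurable
  unfold reflectVel pairHitTime pairDisc
  dsimp only
  fun_prop

/-- **The explicit pair functional of a slab.** For `σ > 0`, `Δ ≥ 0`, a continuous `|w| ≤ b` there is a JOINTLY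
measurable family `φ_{v,u}(q)` — the indicator of Boltzmann's collision cylinder of the relative velocity `v − u` times
the two-body jump `w(v') + w(u') − w(v) − w(u)` at the impact direction `σ⁻¹(q + τ (v − u))` — with `|φ| ≤ 4b`, supported
in the contact shell `σ ≤ ‖q‖ ≤ σ + Δ‖v − u‖`, taking the two-body jump on the cylinder and vanishing off it, and with
`∫ φ_{v,u} = σ²Δ K_w(v, u)` (the clauses of `stub_kinematicAssembly_mainTerm`, uniformly in the pair). [cite: CIP1994, §2.2] -/
theorem exists_pairFunctional : ∀ (σ Δ b : ℝ) (w : V3 → ℝ), 0 < σ → 0 ≤ Δ → Continuous w → (∀ x, |w x| ≤ b) →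
    ∃ φ : V3 → V3 → V3 → ℝ, Measurable (fun p : V3 × V3 × V3 => φ p.1 p.2.1 p.2.2) ∧ (∀ v u q, |φ v u q| ≤ 4 * b) ∧
      (∀ v u q, φ v u q ≠ 0 → σ ≤ ‖q‖ ∧ ‖q‖ ≤ σ + Δ * ‖v - u‖) ∧
      (∀ (v u : V3) (ω : Metric.sphere (0 : V3) 1) (t : ℝ), t ∈ Set.Ioc 0 Δ → inner ℝ (ω : V3) (v - u) < 0 →
        φ v u (σ • (ω : V3) - t • (v - u)) =
          w (reflectVel (σ • (ω : V3)) (v, u)).1 + w (reflectVel (σ • (ω : V3)) (v, u)).2 - w v - w u) ∧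
      (∀ (v u q : V3), (¬ ∃ (ω : Metric.sphere (0 : V3) 1) (t : ℝ), t ∈ Set.Ioc 0 Δ ∧
        inner ℝ (ω : V3) (v - u) < 0 ∧ q = σ • (ω : V3) - t • (v - u)) → φ v u q = 0) ∧
      (∀ v u, ∫ q, φ v u q = σ ^ 2 * Δ * pairKernel w v u) := by
  intro σ Δ b w hσ hΔ hw hwb
  classical
  -- the jump through the impact direction, and the cylinder
  set J : V3 → V3 → V3 → ℝ := fun v u x =>
    w (reflectVel (σ • x) (v, u)).1 + w (reflectVel (σ • x) (v, u)).2 - w v - w u with hJ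
  set C : V3 → V3 → Set V3 := fun v u => {q : V3 | ∃ (ω : Metric.sphere (0 : V3) 1) (t : ℝ), t ∈ Ioc 0 Δ ∧
    ⟪(ω : V3), v - u⟫_ℝ < 0 ∧ q = σ • (ω : V3) - t • (v - u)} with hC
  have hCm : ∀ v u, MeasurableSet (C v u) := fun v u => measurableSet_collisionCylinder hσ (v - u) Δ
  have hJb : ∀ v u x, |J v u x| ≤ 4 * b := fun v u x => abs_fourPoint_le hwb _ _ v u
  refine ⟨fun v u q => (C v u).indicator (fun q => J v u (σ⁻¹ • (q + pairHitTime σ q (v - u) • (v - u)))) q,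
    ?_, ?_, ?_, ?_, ?_, ?_⟩
  · -- joint measurability: the cylinder in hitting-time form is a measurable relation
    have hS : MeasurableSet {p : V3 × V3 × V3 | p.2.2 ∈ C p.1 p.2.1} := by
      have h : {p : V3 × V3 × V3 | p.2.2 ∈ C p.1 p.2.1} = (fun p : V3 × V3 × V3 => (p.2.2, p.1 - p.2.1)) ⁻¹'
          {r : V3 × V3 | PairHits σ r.1 r.2 ∧ 0 < pairDisc σ r.1 r.2 ∧ pairHitTime σ r.1 r.2 ∈ Ioc 0 Δ} := by
        ext p
        exact exists_cylinder_iff_pairHits hσ Δ p.2.2 (p.1 - p.2.1)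
      rw [h]
      exact (measurableSet_cylRel σ Δ).preimage
        ((measurable_snd.comp measurable_snd).prodMk (measurable_fst.sub (measurable_fst.comp measurable_snd)))
    have hG := measurable_twoBodyJump_dir σ hw
    have hfun : (fun p : V3 × V3 × V3 => (C p.1 p.2.1).indicator
        (fun q => J p.1 p.2.1 (σ⁻¹ • (q + pairHitTime σ q (p.1 - p.2.1) • (p.1 - p.2.1)))) p.2.2) =
        fun p : V3 × V3 × V3 => if p.2.2 ∈ C p.1 p.2.1 then
          w (reflectVel (σ • (σ⁻¹ • (p.2.2 + pairHitTime σ p.2.2 (p.1 - p.2.1) • (p.1 - p.2.1)))) (p.1, p.2.1)).1 +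
            w (reflectVel (σ • (σ⁻¹ • (p.2.2 + pairHitTime σ p.2.2 (p.1 - p.2.1) • (p.1 - p.2.1)))) (p.1, p.2.1)).2 -
            w p.1 - w p.2.1 else 0 := by
      funext p
      simp only [Set.indicator_apply, hJ]
    rw [hfun]
    exact Measurable.ite hS hG measurable_const
  · intro v u q
    by_cases hq : q ∈ C v u
    · simp only [indicator_of_mem hq]; exact hJb v u _
    · simp only [indicator_of_notMem hq, abs_zero]; linarith [(abs_nonneg _).trans (hwb 0)]
  · intro v u q hq
    obtain ⟨ω, t, ht, hωu, rfl⟩ : q ∈ C v u := Set.mem_of_indicator_ne_zero hq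
    exact norm_collisionCylinder_mem hσ (v - u) ω ht hωu
  · intro v u ω t ht hωu
    have hmem : σ • (ω : V3) - t • (v - u) ∈ C v u := ⟨ω, t, ht, hωu, rfl⟩
    simp only [indicator_of_mem hmem]
    rw [(collisionCylinder_pairHits hσ (v - u) ω ht.1 hωu).2, sub_add_cancel, smul_smul, inv_mul_cancel₀ hσ.ne',
      one_smul]
  · intro v u q hq
    exact indicator_of_notMem (show q ∉ C v u from hq) _
  · intro v u
    have hJm : Measurable (J v u) := measurable_twoBodyJump σ hw.measurable v u
    change ∫ q, (C v u).indicator (fun q => J v u (σ⁻¹ • (q + pairHitTime σ q (v - u) • (v - u)))) q = _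
    rw [integral_indicator (hCm v u), hC]
    dsimp only
    rw [integral_collisionCylinder_dir hσ hΔ (v - u) (J v u) hJm (hJb v u), pairKernel_eq_integral_incoming w v u hσ.ne']

/-! ## The registered stub: the kinematic assembly -/

/-- The compensator constant `c₂' = c₂σ²/(2n(n−1))` is nonnegative (it is `0` when `n ≤ 1`). [folklore] -/
theorem compensatorConst_nonneg {c₂ : ℝ} (hc₂ : 0 ≤ c₂) (σ : ℝ) (n : ℕ) :
    0 ≤ c₂ * σ ^ 2 / (2 * (n * (n - 1))) := by
  refine div_nonneg (by positivity) ?_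
  rcases Nat.eq_zero_or_pos n with h0 | h0
  · simp [h0]
  · have h1 : (1 : ℝ) ≤ n := by exact_mod_cast h0
    exact mul_nonneg zero_le_two (mul_nonneg (by positivity) (by linarith))

/-- `c₂' n² ≤ c₂ σ²` for the compensator constant `c₂' = c₂σ²/(2n(n−1))` (no pairs when `n ≤ 1`). [folklore] -/
theorem compensatorConst_mul_sq_le {c₂ : ℝ} (hc₂ : 0 ≤ c₂) (σ : ℝ) (n : ℕ) :
    c₂ * σ ^ 2 / (2 * (n * (n - 1))) * (n : ℝ) ^ 2 ≤ c₂ * σ ^ 2 := by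
  rcases lt_or_ge (n : ℝ) 2 with hn | hn
  · have hn' : n ≤ 1 := by
      have h2 : n < 2 := by exact_mod_cast hn
      omega
    have h0 : (n : ℝ) * (n - 1) = 0 := by
      rcases Nat.le_one_iff_eq_zero_or_eq_one.1 hn' with h | h <;> simp [h]
    rw [h0, mul_zero, div_zero, zero_mul]
    positivity
  · rw [div_mul_eq_mul_div, div_le_iff₀ (by nlinarith)]
    have h2 : (n : ℝ) ^ 2 ≤ 2 * (n * (n - 1)) := by nlinarith
    exact mul_le_mul_of_nonneg_left h2 (by positivity)

open Classical in
/-- **Registered stub `stub_kinematicAssemblyOfTail`** (S2d′ of the line `enskog-compensator-martingale`, crux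
stmt-AtomisticToContinuum-13915): **the equal-time Enskog kinematics of the canonical cell law from its statics and the
cluster tail.** For `0 < σ < 3/16`, `CellLawFactorises σ`, `ContactLayerBounds σ`, `ContactStatistics σ` and
`ClusterTail σ` imply `KinematicRates σ`: for a bounded continuous `w` there are `C`, `L₀` such that for `L ≥ L₀`,
`n ≤ 2L³`, every cluster dynamics `Ψ`, with the ONE static constant `c₂' = c₂σ²/(2n(n−1))` (`c₂` the contact constant
of the pair statistics at `(L, n)`), for every continuous velocity functional `|F| ≤ 1` and slab `Δ ∈ (0, 1]`,
`|E_P[F(v(0)) (∑ᵢ [w(vᵢ(Δ)) − w(vᵢ(0))] − Δ c₂' ∑_{i≠j} K_w(vᵢ, vⱼ))]| ≤ C (L³Δ² + L²Δ)`. Proof: free spheres do not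
jump and isolated pairs jump by the static pair functional (pathwise bookkeeping), the remaining spheres and pairs are
controlled in expectation by the cluster tail for `Δ ≤ δ₀`; the static pair functional has expectation
`Δ c₂' ∑ K_w` up to `C(L³Δ² + L²Δ)` by the pair statistics, exchangeability and the contact-layer bound; long slabs
`Δ > δ₀` are crude. [cite: CIP1994, §4.3] -/
theorem stub_kinematicAssemblyOfTail : ∃ σ₀ : ℝ, 0 < σ₀ ∧ ∀ σ : ℝ, 0 < σ → σ < σ₀ → CellLawFactorises σ →
    ContactLayerBounds σ → ContactStatistics σ → ClusterTail σ → KinematicRates σ := by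
  refine ⟨3 / 16, by norm_num, fun σ hσ hσlt hfac hCLB hCS hCT => ?_⟩
  have hσ' : σ ≤ 3 / 16 := hσlt.le
  intro w b hw hwb
  have hb : 0 ≤ b := (abs_nonneg _).trans (hwb 0)
  obtain ⟨C_CLB, hCLB0, hCLB'⟩ := hCLB
  obtain ⟨C_CS, hCS0, L_CS, hL_CS, hCS'⟩ := hCS
  obtain ⟨C_CT, hCT0, δ₀, hδ₀, L_CT, hL_CT, hCT'⟩ := hCT
  -- the constants
  set M₄ : ℝ := ∫ w, (1 + ‖w‖) ^ 4 ∂(stdGaussian V3) with hM₄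
  have hM₄0 : 0 ≤ M₄ := integral_nonneg fun w => by positivity
  set K : ℝ := (8 * C_CLB + 2 * C_CS) / (volume (Metric.ball (0 : V3) (1 / 2))).toReal with hK
  have hK0 : 0 ≤ K := by positivity
  set C_S : ℝ := 8 * M₄ * (4 * b * C_CS + 32 * b * C_CLB + 4 * b * Real.pi * σ ^ 2 * K) with hC_S
  set C_D : ℝ := (4 * b + 64 * b * Real.pi * σ ^ 2 * K * M₄) / δ₀ ^ 2 with hC_D
  have hC_S0 : 0 ≤ C_S := by positivity
  have hC_D0 : 0 ≤ C_D := by positivity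
  refine ⟨4 * b * C_CT + C_S + C_D, max L_CT L_CS, lt_max_of_lt_right (by linarith), fun L hL n hn Ψ => ?_⟩
  have hLCT : L_CT ≤ L := (le_max_left _ _).trans hL
  have hLCS : L_CS ≤ L := (le_max_right _ _).trans hL
  have hL1 : 1 ≤ L := hL_CS.trans hLCS
  have hL0 : 0 < L := by linarith
  obtain ⟨c₂, hc₂, hCS''⟩ := hCS' L hLCS n hn
  have hCLB'' := (hCLB' L hL1 n hn).1
  refine ⟨c₂ * σ ^ 2 / (2 * (n * (n - 1))), compensatorConst_nonneg hc₂ σ n, fun F hF hFb Δ hΔ hΔ1 => ?_⟩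
  haveI : IsProbabilityMeasure (cellLaw σ L n Ψ) := isProbabilityMeasure_cellLaw hσ' hL1 hn (Ψ n)
  haveI : IsProbabilityMeasure (posLaw σ L n) := isProbabilityMeasure_posLaw (posZ_ne_zero hσ' hL1 hn)
  have hKc : c₂ ≤ K * L ^ 3 := c₂_le hσ hL1 hn hCS0 hCLB0 hCS'' hCLB''
  obtain ⟨φ, hφm, hφb, hφs, hon, hoff, hφi⟩ := exists_pairFunctional σ Δ b w hσ hΔ.le hw hwb
  obtain ⟨hKP, hKbound, hSP, hstat⟩ := stub_kinematicAssemblyOfTail_staticMain σ L n Ψ C_CS c₂ C_CLB K b Δ w φ F hσ hσ'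
    hfac hL1 hn hCS0 hc₂ hCLB0 hCS'' hCLB'' hKc hw hwb hΔ hΔ1 hφm hφb hφs hφi hF.measurable hFb
  have hcn : c₂ * σ ^ 2 / (2 * (n * (n - 1))) * (n : ℝ) ^ 2 ≤ c₂ * σ ^ 2 := compensatorConst_mul_sq_le hc₂ σ n
  have hc0 : 0 ≤ c₂ * σ ^ 2 / (2 * (n * (n - 1))) := compensatorConst_nonneg hc₂ σ n
  set c : ℝ := c₂ * σ ^ 2 / (2 * (n * (n - 1))) with hc
  have hLΔ : 0 ≤ L ^ 3 * Δ ^ 2 + L ^ 2 * Δ := by positivity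
  -- the increment part is bounded and measurable
  have hvel : Measurable fun z : Cell n => fun i => (z i).2 := measurable_pi_lambda _ fun i => (measurable_pi_apply i).snd
  have hJi : Integrable (fun z : Cell n => F (fun i => (z i).2) * ∑ i, (w ((Ψ n).flow Δ z i).2 - w (z i).2))
      (cellLaw σ L n Ψ) :=
    Integrable.of_bound ((hF.measurable.comp hvel).mul (measurable_increment Ψ Δ hw.measurable)).aestronglyMeasurable
      (2 * b * n) (ae_of_all _ fun z => by
        rw [Real.norm_eq_abs, abs_mul]
        exact (mul_le_mul (hFb _) (abs_increment_le Ψ Δ hwb z) (abs_nonneg _) zero_le_one).trans_eq (one_mul _))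
  rcases le_or_gt Δ δ₀ with hΔδ | hΔδ
  · -- short slabs: cluster tail + statics
    obtain ⟨hCTa, hCTb⟩ := hCT' L hLCT n hn Ψ Δ hΔ hΔδ
    have hK₁ : 0 ≤ C_CT * (L ^ 3 * Δ ^ 2 + L ^ 2 * Δ) := by positivity
    obtain ⟨hEi, hEb⟩ := stub_kinematicAssemblyOfTail_error σ L n Ψ Δ b (C_CT * (L ^ 3 * Δ ^ 2 + L ^ 2 * Δ))
      (C_CT * (L ^ 3 * Δ ^ 2 + L ^ 2 * Δ)) w φ F hσ hσ' hL1 hn hΔ hw.measurable hwb hφm hφb hon hoff hF.measurable hFb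
      hK₁ hK₁ hCTa hCTb
    have hQi : Integrable (fun z : Cell n => F (fun i => (z i).2) *
        ((1 / 2) * ∑ i, ∑ j, (if i = j then 0 else φ (z i).2 (z j).2 ((z i).1 - (z j).1)) -
          Δ * c * ∑ i, ∑ j, (if i = j then 0 else pairKernel w (z i).2 (z j).2))) (cellLaw σ L n Ψ) :=
      ((hSP.const_mul (1 / 2)).sub (hKP.const_mul (Δ * c))).congr (ae_of_all _ fun z => by
        simp only [Pi.sub_apply]
        ring)
    have hsplit : ∫ z, F (fun i => (z i).2) * ((∑ i, (w ((Ψ n).flow Δ z i).2 - w (z i).2)) -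
        Δ * c * ∑ i, ∑ j, (if i = j then 0 else pairKernel w (z i).2 (z j).2)) ∂(cellLaw σ L n Ψ) =
        (∫ z, F (fun i => (z i).2) * ((∑ i, (w ((Ψ n).flow Δ z i).2 - w (z i).2)) -
          (1 / 2) * ∑ i, ∑ j, (if i = j then 0 else φ (z i).2 (z j).2 ((z i).1 - (z j).1))) ∂(cellLaw σ L n Ψ)) +
        ∫ z, F (fun i => (z i).2) * ((1 / 2) * ∑ i, ∑ j, (if i = j then 0 else φ (z i).2 (z j).2 ((z i).1 - (z j).1)) -
          Δ * c * ∑ i, ∑ j, (if i = j then 0 else pairKernel w (z i).2 (z j).2)) ∂(cellLaw σ L n Ψ) := by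
      rw [← integral_add hEi hQi]
      refine integral_congr_ae (ae_of_all _ fun z => ?_)
      ring
    rw [hsplit]
    calc |(∫ z, F (fun i => (z i).2) * ((∑ i, (w ((Ψ n).flow Δ z i).2 - w (z i).2)) -
            (1 / 2) * ∑ i, ∑ j, (if i = j then 0 else φ (z i).2 (z j).2 ((z i).1 - (z j).1))) ∂(cellLaw σ L n Ψ)) +
          ∫ z, F (fun i => (z i).2) * ((1 / 2) * ∑ i, ∑ j, (if i = j then 0 else φ (z i).2 (z j).2 ((z i).1 - (z j).1)) -
            Δ * c * ∑ i, ∑ j, (if i = j then 0 else pairKernel w (z i).2 (z j).2)) ∂(cellLaw σ L n Ψ)|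
        ≤ (2 * b * (C_CT * (L ^ 3 * Δ ^ 2 + L ^ 2 * Δ)) + 2 * b * (C_CT * (L ^ 3 * Δ ^ 2 + L ^ 2 * Δ))) +
          C_S * (L ^ 3 * Δ ^ 2 + L ^ 2 * Δ) := (abs_add_le _ _).trans (add_le_add hEb hstat)
      _ = (4 * b * C_CT + C_S) * (L ^ 3 * Δ ^ 2 + L ^ 2 * Δ) := by ring
      _ ≤ (4 * b * C_CT + C_S + C_D) * (L ^ 3 * Δ ^ 2 + L ^ 2 * Δ) := by
          have h0 : 0 ≤ C_D * (L ^ 3 * Δ ^ 2 + L ^ 2 * Δ) := by positivity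
          linarith
  · -- long slabs: crude bound
    have hsplit : ∫ z, F (fun i => (z i).2) * ((∑ i, (w ((Ψ n).flow Δ z i).2 - w (z i).2)) -
        Δ * c * ∑ i, ∑ j, (if i = j then 0 else pairKernel w (z i).2 (z j).2)) ∂(cellLaw σ L n Ψ) =
        (∫ z, F (fun i => (z i).2) * ∑ i, (w ((Ψ n).flow Δ z i).2 - w (z i).2) ∂(cellLaw σ L n Ψ)) -
        Δ * c * ∫ z, F (fun i => (z i).2) * ∑ i, ∑ j, (if i = j then 0 else pairKernel w (z i).2 (z j).2)
          ∂(cellLaw σ L n Ψ) := by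
      rw [← integral_const_mul, ← integral_sub hJi (hKP.const_mul _)]
      refine integral_congr_ae (ae_of_all _ fun z => ?_)
      ring
    rw [hsplit]
    have h1 : |∫ z, F (fun i => (z i).2) * ∑ i, (w ((Ψ n).flow Δ z i).2 - w (z i).2) ∂(cellLaw σ L n Ψ)| ≤ 2 * b * n := by
      have h := norm_integral_le_of_norm_le_const (μ := cellLaw σ L n Ψ)
        (f := fun z : Cell n => F (fun i => (z i).2) * ∑ i, (w ((Ψ n).flow Δ z i).2 - w (z i).2)) (C := 2 * b * n)
        (ae_of_all _ fun z => by
          rw [Real.norm_eq_abs, abs_mul]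
          exact (mul_le_mul (hFb _) (abs_increment_le Ψ Δ hwb z) (abs_nonneg _) zero_le_one).trans_eq (one_mul _))
      rwa [probReal_univ, mul_one, Real.norm_eq_abs] at h
    have h2 : |Δ * c * ∫ z, F (fun i => (z i).2) * ∑ i, ∑ j, (if i = j then 0 else pairKernel w (z i).2 (z j).2)
        ∂(cellLaw σ L n Ψ)| ≤ 64 * b * Real.pi * σ ^ 2 * K * M₄ * L ^ 3 := by
      rw [abs_mul, abs_mul, abs_of_pos hΔ, abs_of_nonneg hc0]
      have hI := hKbound
      have h21 : Δ * c * |∫ z, F (fun i => (z i).2) * ∑ i, ∑ j, (if i = j then 0 else pairKernel w (z i).2 (z j).2)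
          ∂(cellLaw σ L n Ψ)| ≤ 1 * c * (64 * b * Real.pi * n ^ 2 * M₄) :=
        mul_le_mul (mul_le_mul_of_nonneg_right hΔ1 hc0) hI (abs_nonneg _) (by positivity)
      have h22 : c * n ^ 2 * (64 * b * Real.pi * M₄) ≤ c₂ * σ ^ 2 * (64 * b * Real.pi * M₄) :=
        mul_le_mul_of_nonneg_right hcn (by positivity)
      have h23 : c₂ * σ ^ 2 * (64 * b * Real.pi * M₄) ≤ K * L ^ 3 * σ ^ 2 * (64 * b * Real.pi * M₄) :=
        mul_le_mul_of_nonneg_right (mul_le_mul_of_nonneg_right hKc (sq_nonneg σ)) (by positivity)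
      calc Δ * c * |∫ z, F (fun i => (z i).2) * ∑ i, ∑ j, (if i = j then 0 else pairKernel w (z i).2 (z j).2)
            ∂(cellLaw σ L n Ψ)| ≤ 1 * c * (64 * b * Real.pi * n ^ 2 * M₄) := h21
        _ = c * n ^ 2 * (64 * b * Real.pi * M₄) := by ring
        _ ≤ K * L ^ 3 * σ ^ 2 * (64 * b * Real.pi * M₄) := h22.trans h23
        _ = 64 * b * Real.pi * σ ^ 2 * K * M₄ * L ^ 3 := by ring
    have h3 : (2 * b * n + 64 * b * Real.pi * σ ^ 2 * K * M₄ * L ^ 3) ≤ C_D * (L ^ 3 * Δ ^ 2 + L ^ 2 * Δ) := by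
      have hΔδ2 : δ₀ ^ 2 ≤ Δ ^ 2 := pow_le_pow_left₀ hδ₀.le hΔδ.le 2
      have hn3 : (n : ℝ) ≤ 2 * L ^ 3 := hn
      calc 2 * b * n + 64 * b * Real.pi * σ ^ 2 * K * M₄ * L ^ 3
          ≤ 2 * b * (2 * L ^ 3) + 64 * b * Real.pi * σ ^ 2 * K * M₄ * L ^ 3 := by gcongr
        _ = (4 * b + 64 * b * Real.pi * σ ^ 2 * K * M₄) * L ^ 3 := by ring
        _ = C_D * (L ^ 3 * δ₀ ^ 2) := by
            have hδ : δ₀ ^ 2 ≠ 0 := pow_ne_zero 2 hδ₀.ne'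
            rw [hC_D, div_mul_eq_mul_div, eq_div_iff hδ]
            ring
        _ ≤ C_D * (L ^ 3 * Δ ^ 2) := mul_le_mul_of_nonneg_left (mul_le_mul_of_nonneg_left hΔδ2 (by positivity)) hC_D0
        _ ≤ C_D * (L ^ 3 * Δ ^ 2 + L ^ 2 * Δ) :=
            mul_le_mul_of_nonneg_left (le_add_of_nonneg_right (by positivity)) hC_D0
    calc |(∫ z, F (fun i => (z i).2) * ∑ i, (w ((Ψ n).flow Δ z i).2 - w (z i).2) ∂(cellLaw σ L n Ψ)) -
          Δ * c * ∫ z, F (fun i => (z i).2) * ∑ i, ∑ j, (if i = j then 0 else pairKernel w (z i).2 (z j).2)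
            ∂(cellLaw σ L n Ψ)|
        ≤ 2 * b * n + 64 * b * Real.pi * σ ^ 2 * K * M₄ * L ^ 3 := (abs_sub _ _).trans (add_le_add h1 h2)
      _ ≤ C_D * (L ^ 3 * Δ ^ 2 + L ^ 2 * Δ) := h3
      _ ≤ (4 * b * C_CT + C_S + C_D) * (L ^ 3 * Δ ^ 2 + L ^ 2 * Δ) := by
          have h0 : 0 ≤ (4 * b * C_CT + C_S) * (L ^ 3 * Δ ^ 2 + L ^ 2 * Δ) := by positivity
          linarith

end Summit.AtomisticToContinuum.HydrodynamicLimit.Theorems.EnskogCompensator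

end
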